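import Literature.Computability.Cryptography.CubicClassTable
import Literature.NumberTheory.CubicFields.PureCubicLatticeCodes
import Literature.NumberTheory.CubicFields.VoronoiChain
import Literature.Computability.Complexity.Randomized
import Mathlib.NumberTheory.NumberField.ClassNumber
import Mathlib.NumberTheory.NumberField.Units.Regulator
import HarnessLib

/-!
# The class-group table: named specifications of the walk programs and the table's structural interface (definitions)

Topic `Computability/Cryptography`; DEFINITIONS ONLY (named `Prop`s), companion of `CubicClassTable.lean`. They name, once
and for all, (a) the SEMANTIC SPECIFICATIONS that the parts of the line `arakelov-giant-step-cycle` of the crux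
`LinnikCubicClassGroups.PureCubicClassGroupFBQP` establish for the walk programs bundled in `CubicClassTable.WalkFns` —
`RedSem` (one reduction step: divide by the unit-cylinder minimum, certified log), `UnitSem` (the unit label of the principal
cycle and the filtered step beyond it), `LatProdSem` (lattice product), `PrimeSem` (degree-one prime codes, Dedekind–Kummer),
`RootsSem` (cube roots modulo `p` from coins) — and (b) the STRUCTURAL INTERFACE `ClassTableInterface` of the power-walk table
`classTableOpP` consumed by its harmonic analysis (`PeriodFinding.corrMass_shiftCell`, `…coset_window_energy_ge`): off small
coin/defect sets the table is a shift-cell table `C_{cls E}((σ E + j) mod 2^s)` whose classes are the cosets of a lattice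
`Λ ≤ ℤ^T` of index the subgroup order, with exact-affine shifts up to rounding and run-shaped cells. Statements of the line refer
to these names and so stay short. [Hallgren 2005, §4; Buchmann–Williams 1988, §3]

## References

* S. Hallgren, STOC 2005, §4. [Hallgren2005]
* J. Buchmann, H. C. Williams, Math. Comp. 50 (1988), §3. [BuchmannWilliams1988]
-/

noncomputable section

namespace Literature.Computability.Cryptography

namespace CubicClassTable

open Literature.Computability.Complexity (uniformProb)
open Literature.NumberTheory.CubicFields (posRelMinima PureCubicCodes.Mem PureCubicCodes.Canon)
open scoped NumberField nonZeroDivisors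

/-- **One reduction step, semantically**: on the canonical code of a nonzero fractional ideal `J`, `redL` divides by the
least-`σ₁` element `γ` of the unit cylinder of `J` (the cylinder minimum) — the result is the canonical code of `γ⁻¹J` — and
returns a `2^prec`-scaled logarithm of `σ₁ γ` certified to `±1` whenever `σ₁ γ ≥ 2^-prec`.
[cite: BuchmannWilliams1988, §3] -/
def RedSem (F : CubicClassTable.WalkFns) (a b : ℕ) (K : Type*) [Field K] [NumberField K] (θ : K)
    (σ₁ : K →+* ℝ) (σ₂ : K →+* ℂ) : Prop :=
  ∀ (prec : ℕ) (c : ℕ × List ℤ) (J : FractionalIdeal (𝓞 K)⁰ K), J ≠ 0 → PureCubicCodes.Canon c → (∀ φ : K, PureCubicCodes.Mem θ b c φ ↔ φ ∈ J) →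
        ∃ γ : K, γ ∈ J ∧ 0 < σ₁ γ ∧ ‖σ₂ γ‖ < 1 ∧ (∀ φ : K, φ ∈ J → 0 < σ₁ φ → ‖σ₂ φ‖ < 1 → σ₁ γ ≤ σ₁ φ) ∧
          PureCubicCodes.Canon (F.redL (((a, b), prec), c)).1 ∧ (∀ φ : K, PureCubicCodes.Mem θ b (F.redL (((a, b), prec), c)).1 φ ↔ φ * γ ∈ J) ∧
          ((1 : ℝ) / 2 ^ prec ≤ σ₁ γ → |((F.redL (((a, b), prec), c)).2 : ℝ) - 2 ^ prec * Real.log (σ₁ γ)| ≤ 1)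

/-- **The unit label and the filtered step beyond it, semantically**: for adequate precision, `unitS` codes a reduced
PRINCIPAL ideal `υ⁻¹𝓞_K` with its certified log `≈ 2^prec log σ₁ υ ≥ 0`, and `rhoS` from it codes a reduced principal ideal
`υ'⁻¹𝓞_K` farther by a certified log in `[log(11/10), 4 log(27a²b²) + 8]` (the big-gap filter). [cite: BuchmannWilliams1988, §3] -/
def UnitSem (F : CubicClassTable.WalkFns) (a b : ℕ) (K : Type*) [Field K] [NumberField K] (θ : K)
    (σ₁ : K →+* ℝ) (σ₂ : K →+* ℂ) : Prop :=
  ∀ prec : ℕ, 4 * Nat.size (a * b) + 8 ≤ prec →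
        ∃ υ υ' : K, 0 < σ₁ υ ∧ 0 < σ₁ υ' ∧
          (1 : K) ∈ posRelMinima σ₁ σ₂ (FractionalIdeal.spanSingleton (𝓞 K)⁰ υ⁻¹) ∧
          (1 : K) ∈ posRelMinima σ₁ σ₂ (FractionalIdeal.spanSingleton (𝓞 K)⁰ υ'⁻¹) ∧
          PureCubicCodes.Canon (F.unitS ((a, b), prec)).1 ∧ (∀ φ : K, PureCubicCodes.Mem θ b (F.unitS ((a, b), prec)).1 φ ↔ φ * υ ∈ (1 : FractionalIdeal (𝓞 K)⁰ K)) ∧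
          |((F.unitS ((a, b), prec)).2 : ℝ) - 2 ^ prec * Real.log (σ₁ υ)| ≤ 8 ∧ 0 ≤ Real.log (σ₁ υ) ∧
          PureCubicCodes.Canon (F.rhoS (((a, b), prec), (F.unitS ((a, b), prec)).1)).1 ∧
          (∀ φ : K, PureCubicCodes.Mem θ b (F.rhoS (((a, b), prec), (F.unitS ((a, b), prec)).1)).1 φ ↔ φ * υ' ∈ (1 : FractionalIdeal (𝓞 K)⁰ K)) ∧
          |((F.rhoS (((a, b), prec), (F.unitS ((a, b), prec)).1)).2 : ℝ) - 2 ^ prec * Real.log (σ₁ υ' / σ₁ υ)| ≤ 8 ∧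
          Real.log (11 / 10) ≤ Real.log (σ₁ υ' / σ₁ υ) ∧ Real.log (σ₁ υ' / σ₁ υ) ≤ 4 * Real.log (27 * (a : ℝ) ^ 2 * (b : ℝ) ^ 2) + 8

/-- **The lattice product, semantically**: canonical code of the `ℤ`-span of the products. [cite: Hallgren2005, §4] -/
def LatProdSem (F : CubicClassTable.WalkFns) (a b : ℕ) (K : Type*) [Field K] (θ : K) : Prop :=
  ∀ c₁ c₂ : ℕ × List ℤ, PureCubicCodes.Canon c₁ → PureCubicCodes.Canon c₂ → PureCubicCodes.Canon (F.latProd ((a, b), (c₁, c₂))) ∧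
        ∀ φ : K, PureCubicCodes.Mem θ b (F.latProd ((a, b), (c₁, c₂))) φ ↔
          φ ∈ AddSubgroup.closure {ψ : K | ∃ ψ₁ ψ₂ : K, PureCubicCodes.Mem θ b c₁ ψ₁ ∧ PureCubicCodes.Mem θ b c₂ ψ₂ ∧ ψ = ψ₁ * ψ₂}

/-- **Degree-one prime codes, semantically** (Dedekind–Kummer at `p ∤ 3ab`): for a root `r` of `X³ ≡ ab² (mod p)` the code
`primeL ((a,b),(ord,(p,r)))` is the canonical code of a prime of norm `p`, distinct roots give distinct primes, and every prime of
norm `p` arises. [cite: Hallgren2005, §4] -/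
def PrimeSem (F : CubicClassTable.WalkFns) (a b : ℕ) (K : Type*) [Field K] [NumberField K] (θ : K) (ord : ℕ × List ℤ) : Prop :=
  ∀ p : ℕ, p.Prime → ¬ p ∣ 3 * (a * b) →
        (∀ r : ℕ, r < p → r ^ 3 % p = (a * b ^ 2) % p →
          PureCubicCodes.Canon (F.primeL ((a, b), (ord, (p, r)))) ∧
          ∃ P : Ideal (𝓞 K), P ∈ nonZeroDivisors (Ideal (𝓞 K)) ∧ P.IsPrime ∧ Ideal.absNorm P = p ∧
            ∀ φ : K, PureCubicCodes.Mem θ b (F.primeL ((a, b), (ord, (p, r)))) φ ↔ ∃ ψ : 𝓞 K, ψ ∈ P ∧ (ψ : K) = φ) ∧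
        (∀ r r' : ℕ, r < p → r' < p → r ^ 3 % p = (a * b ^ 2) % p → r' ^ 3 % p = (a * b ^ 2) % p →
          (∀ φ : K, PureCubicCodes.Mem θ b (F.primeL ((a, b), (ord, (p, r)))) φ ↔ PureCubicCodes.Mem θ b (F.primeL ((a, b), (ord, (p, r')))) φ) → r = r') ∧
        (∀ Q : Ideal (𝓞 K), Q.IsPrime → Ideal.absNorm Q = p → ∃ r : ℕ, r < p ∧ r ^ 3 % p = (a * b ^ 2) % p ∧
          ∀ φ : K, PureCubicCodes.Mem θ b (F.primeL ((a, b), (ord, (p, r)))) φ ↔ ∃ ψ : 𝓞 K, ψ ∈ Q ∧ (ψ : K) = φ)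

/-- **Cube roots modulo `p` from coins, semantically**: the sorted root list is correct for all but a `2^-s'` fraction of coin
strings of length `≥ (s'+1)·24(size p + 2)`. [cite: Hallgren2005, §4] -/
def RootsSem (F : CubicClassTable.WalkFns) : Prop :=
  ∀ (p m' : ℕ), p.Prime → ¬ p ∣ 3 * m' → ∀ (s' ℓ : ℕ), (s' + 1) * (24 * (Nat.size p + 2)) ≤ ℓ →
        uniformProb ℓ {κ | F.roots (p, m', κ) ≠ (List.range p).filter (fun r => r ^ 3 % p = m' % p)} ≤ (1 / 2) ^ s'

/-- **The structural interface of the power-walk class table** `classTableOpP` for admissible data and adequate parameters: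
the hidden lattice `Λ ≤ ℤ^T` (`T = 3|ps|`) has index the order of the subgroup of `Cl(𝓞_K)` generated by the degree-one primes
above `ps`; off a small set of coin values the table ignores the coins; off a small defect set it is the shift-cell table
`C_{cls E}((σ E + j) mod 2^s)` of classes = cosets of `Λ` through the digit vectors, with class-disjoint cell values,
exact-affine shifts up to rounding (`y`, `μ`), and run-shaped cells, few per class. [cite: Hallgren2005, §4] -/
def ClassTableInterface (F : CubicClassTable.WalkFns) (a b : ℕ) (K : Type*) [Field K] [NumberField K]
    (ord : ℕ × List ℤ) : Prop :=
  ∀ (m : ℕ) (ps : List ℕ) (r k : ℕ), (∀ p ∈ ps, p.Prime ∧ ¬ p ∣ 3 * m) → (∃ f : ℕ, 0 < f ∧ m = f ^ 3 * (a * b ^ 2)) →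
      |(r : ℝ) - 2 ^ k * NumberField.Units.regulator K| ≤ 1 →
      ∀ (ℓe npp ℓy ℓκ ℓb prec s s₀ Tdbl Bfin Bb margin cap : ℕ),
        -- parameter adequacy (explicit, generous; `LD` abbreviates `Nat.size (27 * a ^ 2 * b ^ 2)`)
        20 ≤ ℓe → s + npp + 60 + 6 * Nat.size (27 * a ^ 2 * b ^ 2) ≤ k → k + s + npp + 64 ≤ prec → npp + 6 * Nat.size (27 * a ^ 2 * b ^ 2) + 50 ≤ s → s ≤ ℓy →
        prec + 6 * Nat.size (27 * a ^ 2 * b ^ 2) + 10 ≤ Tdbl → margin = 2 ^ prec * ((2 * Tdbl + 4) * (10 * Nat.size (a * b) + 48)) →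
        60 * (2 * Tdbl + 4) * (10 * Nat.size (a * b) + 48) + 12 ≤ Bb →
        (∀ p ∈ ps, ∀ c : ℕ × List ℤ, PureCubicCodes.Canon c → c.1 ≤ 243 * a ^ 2 * b ^ 2 * p → (∀ h ∈ c.2, h.natAbs ≤ 243 * a ^ 2 * b ^ 2 * p) → True) →
        (∀ p ∈ ps, (243 * a ^ 2 * b ^ 2 * (p + 1)) ^ 2 ≤ cap) → ℓb = 24 * (Nat.size cap + 2) * 50 → ps.length * ℓb ≤ ℓκ →
        ∃ (Λ : AddSubgroup (Fin (3 * ps.length) → ℤ)) (_ : Λ.FiniteIndex)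
          (F₀ : ℕ → (ℕ × List ℤ) × ℕ) (cls σ : ℕ → ℕ) (C : ℕ → ℕ → (ℕ × List ℤ) × ℕ) (y : ℕ → ℝ)
          (μ : Fin (3 * ps.length) → ℝ) (Badκ D : Finset ℕ),
          -- the hidden lattice is the relation lattice of the degree-one primes: its index is the subgroup order
          Λ.index = Nat.card (Subgroup.closure {c : ClassGroup (𝓞 K) | ∃ p ∈ ps, ∃ P : Ideal (𝓞 K),
            ∃ hP : P ∈ nonZeroDivisors (Ideal (𝓞 K)), c = ClassGroup.mk0 ⟨P, hP⟩ ∧ P.IsPrime ∧ Ideal.absNorm P = p}) ∧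
          -- (ii) coins: off a small bad set the table does not depend on the coin block (nor on the padding above it)
          (Badκ.card : ℝ) ≤ (1 / 2) ^ 40 * 2 ^ ℓκ ∧
          (∀ v : ℕ, (v / ((2 ^ ℓe) ^ (3 * ps.length) * 2 ^ ℓy)) % 2 ^ ℓκ ∉ Badκ →
            F.classTableOpP ⟨a, b, m, ps, ord, r, k, prec, s, ℓe, npp, ℓy, ℓκ, ℓb, s₀, Tdbl, Bfin, Bb, margin⟩ cap v =
              F₀ (v % ((2 ^ ℓe) ^ (3 * ps.length) * 2 ^ ℓy))) ∧
          -- (iii) the shift-cell idealisation off a small defect set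
          (D.card : ℝ) ≤ (1 / 2) ^ 30 * ((2 ^ ℓe) ^ (3 * ps.length) * 2 ^ ℓy : ℕ) ∧
          (∀ E < (2 ^ ℓe) ^ (3 * ps.length), ∀ j < 2 ^ ℓy, E + (2 ^ ℓe) ^ (3 * ps.length) * j ∉ D →
            F₀ (E + (2 ^ ℓe) ^ (3 * ps.length) * j) = C (cls E) ((σ E + j) % 2 ^ s)) ∧
          -- (iv) classes = cosets of Λ (through the digit vectors); cell values of distinct classes are distinct
          (∀ E < (2 ^ ℓe) ^ (3 * ps.length), ∀ E' < (2 ^ ℓe) ^ (3 * ps.length), cls E = cls E' ↔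
            (fun t : Fin (3 * ps.length) => ((E / (2 ^ ℓe) ^ (t : ℕ) % 2 ^ ℓe : ℕ) : ℤ) -
              ((E' / (2 ^ ℓe) ^ (t : ℕ) % 2 ^ ℓe : ℕ) : ℤ)) ∈ Λ) ∧
          (∀ E < (2 ^ ℓe) ^ (3 * ps.length), ∀ E' < (2 ^ ℓe) ^ (3 * ps.length), ∀ i < 2 ^ s, ∀ i' < 2 ^ s,
            C (cls E) i = C (cls E') i' → cls E = cls E') ∧
          -- (v) the shifts are exact-affine along the classes up to rounding
          (∀ E < (2 ^ ℓe) ^ (3 * ps.length), |(σ E : ℝ) - y E| ≤ 1) ∧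
          (∀ E < (2 ^ ℓe) ^ (3 * ps.length), ∀ E' < (2 ^ ℓe) ^ (3 * ps.length), cls E = cls E' →
            ∃ z : ℤ, y E' - y E + 2 ^ s * ∑ t : Fin (3 * ps.length), μ t *
              (((E' / (2 ^ ℓe) ^ (t : ℕ) % 2 ^ ℓe : ℕ) : ℝ) - ((E / (2 ^ ℓe) ^ (t : ℕ) % 2 ^ ℓe : ℕ) : ℝ)) = 2 ^ s * z) ∧
          -- (vi) cells: fibres are at most two intervals; few cells per class
          (∀ E < (2 ^ ℓe) ^ (3 * ps.length),
            (∀ ω ∈ (Finset.range (2 ^ s)).image (C (cls E)), ∃ b₁ b₂ b₁' b₂' : ℕ,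
              Disjoint (Finset.Ico b₁ b₂) (Finset.Ico b₁' b₂') ∧
              (Finset.range (2 ^ s)).filter (fun i => C (cls E) i = ω) = Finset.Ico b₁ b₂ ∪ Finset.Ico b₁' b₂') ∧
            ((Finset.range (2 ^ s)).image (C (cls E))).card ≤ 2 ^ (npp + 2) * (27 * a ^ 2 * b ^ 2) ^ 6 + 2 ^ 10)

end CubicClassTable

end Literature.Computability.Cryptography
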